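import Literature.NumberTheory.EllipticCurves.HeckeOperatorsProofs
import Literature.NumberTheory.EllipticCurves.CuspFormLFunction
import Literature.NumberTheory.EllipticCurves.NewformGaloisRepIntegralityProofs
import HarnessLib

/-!
# The level-lowering operator `U_p↓ : S_k(Γ₀(N)) → S_k(Γ₀(M))` (`N ∣ Mp`, `p ∣ M`) as a Hecke correspondence (ENGINE E1)

Cell `bsd-f2-manin`, route `ManinLocalTwoThree`, crux C2 `ManinOddAtFour` (stmt-BirchSwinnertonDyer-22967) / C3; an g59, engine ask E1 of
MEMO-an §104 (the ROOT SQUEEZES of level `171 = 9·19` need the root forms `ι₁φ₁₉, ι₁φ₅₇ₓ` as LEVEL-57 OBJECTS built from level-171 data).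

**The operator.** For a prime `p`, levels `N ∣ M·p` with `p ∣ M`, the tree's Hecke correspondence
`[Γ₀(N) diag(1,p) Γ₀(M)] = cuspHeckeCorrespondence (Γ₀ N) (Γ₀ M) k diag(1,p) : S_k(Γ₀(N)) → S_k(Γ₀(M))` is the operator
`f ↦ ∑_{j mod p} f ∣[k] (1 j; 0 p)` (`coe_lowerU_eq_sum`) — the SAME sum as `U_p = heckeT (Γ₀ N) k p` when `p ∣ N`
(`coe_lowerU_eq_coe_heckeT`), but landing at the LOWER level `M`: `aₙ(U_p↓ f) = a_{pn}(f)` (`cuspCoeff_lowerU`).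
Coset computation (Diamond–Shurman §5.2 / Ex. 5.2.4 with two levels): `diag(1,p)⁻¹ Γ₀(N) diag(1,p) ∩ Γ₀(M) = Γ₀(M) ∩ Γ⁰(p)` has
index `p` in `Γ₀(M)` because `p ∣ M` forces `p ∤ a` for `(a b; c d) ∈ Γ₀(M)`; representatives `Tʲ`, `j mod p`
(`exists_mul_tpB_eq_iff_of_dvd`, `existsUnique_fin_lower`); the double coset formula is the tree's
`heckeCorrespondence_apply_eq_sum_slash_holds`.
USE (an g59 §104, LEAD): with `N = 171, M = 57, p = 3` and `w ∈ S₂(Γ₀(171))` a certified `ℤ`-combination of g58's Hecke-closure basis,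
`f₀ := lowerU 3 171 57 w : CuspForm (Gamma0 57) 2` has the certified table `aₙ(f₀) = a₃ₙ(w)`; §104's recipes give `w` with `f₀ = ι₁φ₁₉`,
`ι₁φ₅₇ₐ`, … — the root forms the weight-6 squeezes consume.  Iterating (`57 → 19`) reaches `S₂(Γ₀(19))`.
HONEST FRAMING: unconditional operator calculus over the tree's definitions; standard axioms; nothing here is specific to elliptic curves,
nothing proves C2/C3, Manin's conjecture or BSD.
[cite: DiamondShurman2005, Prop. 5.2.1, Ex. 5.2.4] [cite: Shimura1971, Prop. 3.1 and (3.4.4)]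
-/

set_option autoImplicit false
-- lint-debt: the directory name repeats the summit name (sibling precedent `ManinLocalTwoThreePinningKernelHecke.lean`)
set_option linter.dupNamespace false

noncomputable section

open scoped MatrixGroups ModularForm
open CongruenceSubgroup Matrix ModularGroup
open Literature.NumberTheory.EllipticCurves.ModularForms

namespace Summit.BirchSwinnertonDyer.BirchSwinnertonDyer.Theorems.ManinLocalTwoThree.HeckeLevelLowering

/-! ## §1 Cosets of `Γ₀(N) diag(1,p) Γ₀(M)` for `N ∣ Mp`, `p ∣ M` -/

section Cosets

variable (p : ℕ) [NeZero p] (N M : ℕ)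

/-- `γ·diag(1,p) = diag(1,p)·A` is solvable with `γ ∈ Γ₀(N)` iff `p ∣ A₀₁`, for `A ∈ Γ₀(M)` and `N ∣ M·p`
(`diag(1,p) A diag(1,p)⁻¹ = (a, b/p; pc, d)`). [cite: DiamondShurman2005, Ex. 5.2.4] -/
theorem exists_mul_tpG_eq_iff_of_dvd {A : SL(2, ℤ)} (hA : A ∈ Gamma0 M) (hN : N ∣ M * p) :
    (∃ γ ∈ ((Gamma0 N : Subgroup SL(2, ℤ)) : Subgroup (GL (Fin 2) ℝ)),
      γ * tpG p = tpG p * Matrix.SpecialLinearGroup.mapGL ℝ A) ↔ (p : ℤ) ∣ A 0 1 := by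
  constructor
  · rintro ⟨γ, hγ, h⟩
    obtain ⟨g, -, rfl⟩ := Subgroup.mem_map.mp hγ
    have h01 := congrArg (fun B : GL (Fin 2) ℝ ↦ (B : Matrix (Fin 2) (Fin 2) ℝ) 0 1) h
    simp only [Matrix.GeneralLinearGroup.coe_mul, val_tpG, val_mapGL', Matrix.mul_apply,
      Fin.sum_univ_two] at h01
    simp at h01
    refine ⟨g 0 1, ?_⟩
    exact_mod_cast (by rw [← h01]; ring : (A 0 1 : ℝ) = p * g 0 1)
  · rintro ⟨b, hb⟩
    have hdet := det_entries A
    let γ : SL(2, ℤ) := ⟨!![A 0 0, b; p * A 1 0, A 1 1], by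
      rw [Matrix.det_fin_two_of]; linear_combination hdet + (A 1 0) * hb⟩
    have hγ : γ ∈ Gamma0 N := by
      have hc : (M : ℤ) ∣ A 1 0 := dvd_entry_of_mem_Gamma0 M hA
      have hNc : (N : ℤ) ∣ p * A 1 0 := by
        have h1 : (N : ℤ) ∣ (M : ℤ) * p := by exact_mod_cast hN
        exact h1.trans (by rw [mul_comm]; exact mul_dvd_mul_left (p : ℤ) hc)
      have hz : ((p * A 1 0 : ℤ) : ZMod N) = 0 := (ZMod.intCast_zmod_eq_zero_iff_dvd _ N).mpr hNc
      rw [Gamma0_mem]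
      simpa [γ] using hz
    refine ⟨_, Subgroup.mem_map_of_mem _ hγ, ?_⟩
    ext i j
    fin_cases i <;> fin_cases j <;>
      simp [val_tpG, Matrix.mul_apply, Fin.sum_univ_two, γ, hb] <;> ring

/-- `γ·(1 j; 0 p) = diag(1,p)·A` is solvable with `γ ∈ Γ₀(N)` iff `p ∣ A₀₁ − j·A₀₀`, for `A ∈ Γ₀(M)`, `N ∣ M·p`.
[cite: DiamondShurman2005, Ex. 5.2.4] -/
theorem exists_mul_tpB_eq_iff_of_dvd {A : SL(2, ℤ)} (hA : A ∈ Gamma0 M) (hN : N ∣ M * p) (j : ℤ) :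
    (∃ γ ∈ ((Gamma0 N : Subgroup SL(2, ℤ)) : Subgroup (GL (Fin 2) ℝ)),
      γ * tpB p j = tpG p * Matrix.SpecialLinearGroup.mapGL ℝ A) ↔
      (p : ℤ) ∣ A 0 1 - j * A 0 0 := by
  have hAT : A * T ^ (-j) ∈ Gamma0 M := mul_mem hA (T_zpow_mem_Gamma0 M (-j))
  have key := exists_mul_tpG_eq_iff_of_dvd p N M hAT hN
  have h01 : (A * T ^ (-j)) 0 1 = A 0 1 - j * A 0 0 := by
    change ((A : Matrix (Fin 2) (Fin 2) ℤ) * (T ^ (-j) : SL(2, ℤ))) 0 1 = _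
    rw [coe_T_zpow]
    simp [Matrix.mul_apply, Fin.sum_univ_two]
    ring
  rw [h01] at key
  rw [← key]
  refine exists_congr fun γ ↦ and_congr_right fun _ ↦ ?_
  rw [tpB, map_mul, map_zpow _ T (-j), _root_.zpow_neg, ← map_zpow, ← mul_assoc (tpG p),
    eq_mul_inv_iff_mul_eq, mul_assoc]

/-- `(1 j; 0 p) = 1 · diag(1,p) · Tʲ ∈ Γ₀(N) diag(1,p) Γ₀(M)`. [folklore] -/
theorem tpB_mem_doubleCoset_lower (j : ℤ) :
    tpB p j ∈ DoubleCoset.doubleCoset (tpG p)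
      (((Gamma0 N : Subgroup SL(2, ℤ)) : Subgroup (GL (Fin 2) ℝ)) : Set (GL (Fin 2) ℝ))
      (((Gamma0 M : Subgroup SL(2, ℤ)) : Subgroup (GL (Fin 2) ℝ)) : Set (GL (Fin 2) ℝ)) :=
  DoubleCoset.mem_doubleCoset.mpr ⟨1, one_mem _, _, Subgroup.mem_map_of_mem _ (T_zpow_mem_Gamma0 M j),
    by simp [tpB]⟩

/-- **Coset decomposition `Γ₀(N) diag(1,p) Γ₀(M) = ⊔_{j mod p} Γ₀(N) (1 j; 0 p)`** for `p ∣ M`, `N ∣ M·p`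
(`p ∣ M ∣ c` forces `p ∤ a`, so `j ≡ b·a⁻¹ (mod p)` is the unique index). [cite: DiamondShurman2005, Ex. 5.2.4] -/
theorem existsUnique_fin_lower [Fact p.Prime] (hpM : p ∣ M) (hN : N ∣ M * p) (x : GL (Fin 2) ℝ)
    (hx : x ∈ DoubleCoset.doubleCoset (tpG p)
      (((Gamma0 N : Subgroup SL(2, ℤ)) : Subgroup (GL (Fin 2) ℝ)) : Set (GL (Fin 2) ℝ))
      (((Gamma0 M : Subgroup SL(2, ℤ)) : Subgroup (GL (Fin 2) ℝ)) : Set (GL (Fin 2) ℝ))) :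
    ∃! j : Fin p, x * (tpB p ((j : ℕ) : ℤ))⁻¹ ∈
      ((Gamma0 N : Subgroup SL(2, ℤ)) : Subgroup (GL (Fin 2) ℝ)) := by
  obtain ⟨x₁, hx₁, x₂, hx₂, rfl⟩ := DoubleCoset.mem_doubleCoset.mp hx
  obtain ⟨A, hA, rfl⟩ := Subgroup.mem_map.mp hx₂
  simp_rw [mul_inv_mem_iff_exists hx₁, exists_mul_tpB_eq_iff_of_dvd p N M hA hN]
  refine existsUnique_fin_dvd_sub_mul (A 0 1) ?_
  exact not_dvd_of_dvd (det_entries A)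
    ((Int.natCast_dvd_natCast.mpr hpM).trans (dvd_entry_of_mem_Gamma0 M hA))

end Cosets

/-! ## §2 The operator `lowerU p N M = [Γ₀(N) diag(1,p) Γ₀(M)]` and its `q`-expansion -/

section Operator

variable (p N M : ℕ) [NeZero p] [NeZero N] [NeZero M] (k : ℤ)

/-- **`U_p↓ : S_k(Γ₀(N)) →ₗ[ℂ] S_k(Γ₀(M))`**, the Hecke correspondence `[Γ₀(N) diag(1,p) Γ₀(M)]` (meaningful for `N ∣ M·p`,
`p ∣ M`: then `aₙ(U_p↓ f) = a_{pn}(f)`, `cuspCoeff_lowerU`). [cite: Shimura1971, Prop. 3.1 and (3.4.4)] -/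
def lowerU : CuspForm (Gamma0 N) k →ₗ[ℂ] CuspForm (Gamma0 M) k :=
  cuspHeckeCorrespondenceₗ (Gamma0 N) (Gamma0 M) k (diagGL 1 p one_pos (Nat.cast_pos.mpr (NeZero.pos p)))

/-- `lowerU` is the (additive) `cuspHeckeCorrespondence` at `diag(1,p)`. [folklore] -/
theorem lowerU_apply (f : CuspForm (Gamma0 N) k) : lowerU p N M k f =
    cuspHeckeCorrespondence (Gamma0 N) (Gamma0 M) k
      ((diagGL 1 p one_pos (Nat.cast_pos.mpr (NeZero.pos p)) : GL(2, ℚ)⁺) : GL (Fin 2) ℚ) f := rfl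

/-- **`U_p↓ f = ∑_{j mod p} f ∣[k] (1 j; 0 p)`** for `p ∣ M`, `N ∣ M·p` (Diamond–Shurman Prop. 5.2.1 across two levels).
[cite: DiamondShurman2005, Prop. 5.2.1, Ex. 5.2.4] -/
theorem coe_lowerU_eq_sum [Fact p.Prime] (hpM : p ∣ M) (hN : N ∣ M * p) (f : CuspForm (Gamma0 N) k) :
    ⇑(lowerU p N M k f) = ∑ j : Fin p, ⇑f ∣[k] tpB p ((j : ℕ) : ℤ) := by
  rw [lowerU_apply, coe_cuspHeckeCorrespondence]
  exact heckeCorrespondence_apply_eq_sum_slash_holds _ _ k _ (fun j : Fin p ↦ tpB p ((j : ℕ) : ℤ))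
    (fun j ↦ tpB_mem_doubleCoset_lower p N M _) (existsUnique_fin_lower p N M hpM hN) _

/-- **`U_p↓ f` and `U_p f` are the same function on `ℍ`** (`p ∣ N`, `p ∣ M`, `N ∣ M·p`): level lowering by `U_p` is the tree's `heckeT`
read at level `M`. [cite: DiamondShurman2005, Prop. 5.2.1] -/
theorem coe_lowerU_eq_coe_heckeT [Fact p.Prime] (hpM : p ∣ M) (hN : N ∣ M * p) (hpN : p ∣ N)
    (f : CuspForm (Gamma0 N) k) : ⇑(lowerU p N M k f) = ⇑(heckeT (Gamma0 N) k p f) := by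
  rw [coe_lowerU_eq_sum p N M k hpM hN f, coe_heckeT_gamma0_eq_sum N k p Fact.out f, if_pos hpN, add_zero]

/-- **`aₙ(U_p↓ f) = a_{pn}(f)`** (`p ∣ N`, `p ∣ M`, `N ∣ M·p`; Diamond–Shurman Prop. 5.2.2 for `U_p`).
[cite: DiamondShurman2005, Prop. 5.2.2] -/
theorem cuspCoeff_lowerU [Fact p.Prime] (hpM : p ∣ M) (hN : N ∣ M * p) (hpN : p ∣ N)
    (f : CuspForm (Gamma0 N) k) (n : ℕ) : cuspCoeff (lowerU p N M k f) n = cuspCoeff f (p * n) := by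
  unfold cuspCoeff
  rw [coe_lowerU_eq_coe_heckeT p N M k hpM hN hpN f, qExpansion_coeff_heckeT_holds N k f p Fact.out n,
    if_pos hpN, add_zero]

/-- `aₙ` of a `ℤ`-combination lowered: `aₙ(U_p↓ (∑ cᵢ • gᵢ)) = ∑ cᵢ · a_{pn}(gᵢ)` — the table of a lowered word from the tables
of the basis. [folklore] -/
theorem cuspCoeff_lowerU_sum [Fact p.Prime] (hpM : p ∣ M) (hN : N ∣ M * p) (hpN : p ∣ N) {ι : Type*}
    (s : Finset ι) (c : ι → ℂ) (g : ι → CuspForm (Gamma0 N) k) (n : ℕ) :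
    cuspCoeff (lowerU p N M k (∑ i ∈ s, c i • g i)) n = ∑ i ∈ s, c i * cuspCoeff (g i) (p * n) := by
  rw [cuspCoeff_lowerU p N M k hpM hN hpN,
    ← cuspCoeffₗ_apply (one_mem_strictPeriods_coe_gamma0 N) (p * n), map_sum]
  refine Finset.sum_congr rfl fun i _ ↦ ?_
  rw [map_smul, smul_eq_mul, cuspCoeffₗ_apply]

end Operator

/-! ## §3 The instances the root squeezes use: `171 → 57 → 19` (`p = 3`) and `99 → 33 → 11`, `117 → 39`, `207 → 69` -/

/-- `aₙ(U₃↓ f) = a₃ₙ(f)` for `f ∈ S_k(Γ₀(171))`, `U₃↓ f ∈ S_k(Γ₀(57))`. [cite: DiamondShurman2005, Prop. 5.2.2] -/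
theorem cuspCoeff_lowerU_171_57 (k : ℤ) (f : CuspForm (Gamma0 171) k) (n : ℕ) :
    cuspCoeff (haveI : Fact (Nat.Prime 3) := ⟨Nat.prime_three⟩; lowerU 3 171 57 k f) n = cuspCoeff f (3 * n) :=
  haveI : Fact (Nat.Prime 3) := ⟨Nat.prime_three⟩
  cuspCoeff_lowerU 3 171 57 k ⟨19, rfl⟩ ⟨1, rfl⟩ ⟨57, rfl⟩ f n

/-- `aₙ(U₃↓ f) = a₃ₙ(f)` for `f ∈ S_k(Γ₀(57))`, `U₃↓ f ∈ S_k(Γ₀(19))` — NOT available: `3 ∤ 19`, the coset count is `4`, not `3`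
(the correspondence `[Γ₀(57) diag(1,3) Γ₀(19)]` is `U₃↓ + (twisted trace term)`); the root `19a` is reached instead as `ι₁φ₁₉ ∈ S₂(Γ₀(57))`
(level `57` object, which is all the weight-6 squeeze at level `57` needs). This `example` records the available `171 → 57` step only. [folklore] -/
example (f : CuspForm (Gamma0 171) 2) (n : ℕ) :
    cuspCoeff (haveI : Fact (Nat.Prime 3) := ⟨Nat.prime_three⟩; lowerU 3 171 57 2 f) n = cuspCoeff f (3 * n) :=
  cuspCoeff_lowerU_171_57 2 f n

/-- `aₙ(U₃↓ f) = a₃ₙ(f)` for `f ∈ S_k(Γ₀(117))`, `U₃↓ f ∈ S_k(Γ₀(39))` (root `39a` of `117 = 9·13`). [cite: DiamondShurman2005, Prop. 5.2.2] -/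
theorem cuspCoeff_lowerU_117_39 (k : ℤ) (f : CuspForm (Gamma0 117) k) (n : ℕ) :
    cuspCoeff (haveI : Fact (Nat.Prime 3) := ⟨Nat.prime_three⟩; lowerU 3 117 39 k f) n = cuspCoeff f (3 * n) :=
  haveI : Fact (Nat.Prime 3) := ⟨Nat.prime_three⟩
  cuspCoeff_lowerU 3 117 39 k ⟨13, rfl⟩ ⟨1, rfl⟩ ⟨39, rfl⟩ f n

/-- `aₙ(U₃↓ f) = a₃ₙ(f)` for `f ∈ S_k(Γ₀(207))`, `U₃↓ f ∈ S_k(Γ₀(69))` (root `69a` of `207 = 9·23`). [cite: DiamondShurman2005, Prop. 5.2.2] -/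
theorem cuspCoeff_lowerU_207_69 (k : ℤ) (f : CuspForm (Gamma0 207) k) (n : ℕ) :
    cuspCoeff (haveI : Fact (Nat.Prime 3) := ⟨Nat.prime_three⟩; lowerU 3 207 69 k f) n = cuspCoeff f (3 * n) :=
  haveI : Fact (Nat.Prime 3) := ⟨Nat.prime_three⟩
  cuspCoeff_lowerU 3 207 69 k ⟨23, rfl⟩ ⟨1, rfl⟩ ⟨69, rfl⟩ f n

/-- `aₙ(U₂↓ f) = a₂ₙ(f)` for `f ∈ S_k(Γ₀(176))`, `U₂↓ f ∈ S_k(Γ₀(88))` (the `2`-adic tower `176 → 88 → 44 → 22`). [cite: DiamondShurman2005, Prop. 5.2.2] -/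
theorem cuspCoeff_lowerU_176_88 (k : ℤ) (f : CuspForm (Gamma0 176) k) (n : ℕ) :
    cuspCoeff (haveI : Fact (Nat.Prime 2) := ⟨Nat.prime_two⟩; lowerU 2 176 88 k f) n = cuspCoeff f (2 * n) :=
  haveI : Fact (Nat.Prime 2) := ⟨Nat.prime_two⟩
  cuspCoeff_lowerU 2 176 88 k ⟨44, rfl⟩ ⟨1, rfl⟩ ⟨88, rfl⟩ f n

end Summit.BirchSwinnertonDyer.BirchSwinnertonDyer.Theorems.ManinLocalTwoThree.HeckeLevelLowering

end
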